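import Mathlib.Analysis.InnerProductSpace.Basic
import HarnessLib

/-!
# Route `UnitScaleTilt`, crux K1 child «MinimiserStabilityRegPr» (stmt-QuantumFields-19200), skeleton v10, stub `stub_existenceMinimalOrbit`, route (β) —
# THE CONVEX SKELETON OF THE INTERIORITY SENTENCE: a cap that is STRICT at the free fibre-minimiser of a quadratic functional is strict at EVERY minimiser over
# EVERY capped subset containing it — and nothing weaker of this kind holds (the model of [Balaban1985Variational] Sect. F «(158) with a sign»)

Cell `ym3-torus` (HUMAN RULING D-0037, YM ladder rung R3), width seat `ym-ust-20520-w2` (g2), assisting the INTERIOR-sentence owner ★19200-w4 g0 on route (β)'s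
PLAQUETTE half `hPl` ∕ `hPlₚ` (OWNER 2026-08-28 01:18:38Z; texts `Prop7ClosedFibreInteriorAtR.interiorAtR_of_halves`, p593577).  THEOREMS ONLY (0 `def`, 0 `sorry`),
Mathlib-only.  YM₃ on T³ is a ladder rung (R3), not the Clay problem; nothing here claims the stub, the crux, d = 4 or the mass gap.

WHY THIS FILE.  The plaquette half of the interiority sentence says: a minimiser `Ū` of the Wilson action over the CLOSED regular fibre
`(6̄)(R) ∩ 𝔅_k(V)` (plaquette cap `|U(∂p) − 1| ≤ R·L^{−2k}`, i.e. `A_p(U) = ½|U(∂p) − 1|² ≤ ½R²L^{−4k}` — `MinimiserStabilityRegPrAvgActionDefect.one_sub_reTr_eq_half_dist1_sq_su2`)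
has every cap STRICT.  The located analysis of the (β) seats (★19200-w4 g0 `INTERIOR-ANALYSIS-w4-g0.md` §2–§4; this seat's STATUS 2026-08-28 PROGRESS 3: multiplier mass
`Σμ ≲ #plaq·(ε₁/R)²`, `sup μ ≲ L^{−k}·diam(active cluster)`) is that the sentence is an L^∞ a-priori estimate whose CONVEX SKELETON is the elastic–plastic-torsion fact:
a gradient-capped convex problem has no plastic zone exactly when the UNCAPPED minimiser obeys the cap strictly.  This file records that skeleton as a kernel theorem, in the
abstract (real inner-product) setting the chart functional `𝔊(A′) ≈ ½‖dA′‖²` of [Balaban1985Variational] (157) lives in: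

* ★ `map_eq_of_isMinOn_subset` — `E = ‖d ·‖²` for a linear `d : V → W`, `S ⊆ V` CONVEX (the affine fibre `{Q A = B}` ∩ a chart ball), `K ⊆ S` ANY subset (the capped
  fibre — no convexity asked of the caps), `A* ∈ K` a minimiser of `E` over `S`, `Ā` a minimiser of `E` over `K` ⟹ `d Ā = d A*` (parallelogram law at the midpoint,
  which lies in `S`).  Hence every cap that is a condition on `d A` (plaquette = curvature caps) takes the SAME values at `Ā` as at `A*`:
* `cap_iff_of_isMinOn_subset`, `strictCap_of_isMinOn_subset` — strict caps at the free minimiser ⟹ strict caps at every capped minimiser (INTERIOR);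
* `isMinOn_of_isMinOn_subset_of_mem` — conversely (any function, any sets) the capped minimum IS the free minimum as soon as the free minimiser is feasible (the «flat step» of the closed
  minimum `m̄(σ)`, ★19200-w4's `Prop7ClosedFibreHalving` §3, in the model).
WHAT THIS SAYS FOR (β) (documentary): interiority of closed-fibre minimisers FOLLOWS from, and in the convex model is EQUIVALENT to, the strict cap at the free
fibre-minimiser — i.e. the sup-norm location of the unconstrained critical point ([Balaban1985Variational] Props 5–6 + Prop. 8 ∕ [Balaban1985BackgroundPropagators]
Thm 3.13), the route-(α) core; the direct method on the closed fibre (`Prop7ClosedFibreMinimiser`, p591314) replaces print's «(142) + covering ⇒ minimality» by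
«convexity ⇒ the closed minimiser has the free minimiser's curvature», not the sup-norm propagator estimates.  HONEST SCOPE: linear algebra in a real inner-product space;
NOTHING of [Balaban1985Variational] is asserted; `hPl` is NOT proved here; `--supports stmt-QuantumFields-19200`, count-neutral.

References: T. Bałaban, CMP 102 (1985) 277–309 [Balaban1985Variational] ((2), (5)–(6) p.278, Prop. 7 p.299, (142) p.299, (157)–(158) p.302, Prop. 8 p.304);
CMP 99 (1985) 389–434 [Balaban1985BackgroundPropagators] (Thm 3.13 p.424).
-/

set_option autoImplicit false

namespace Summit.QuantumFields.YangMills.Theorems.Prop7ClosedFibrePlaqInteriorModel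

open Set

variable {V W : Type*} [AddCommGroup V] [Module ℝ V] [NormedAddCommGroup W] [InnerProductSpace ℝ W]

/-- ★ **THE CONVEX SKELETON OF INTERIORITY**: for a linear `d : V → W` into a real inner-product space, a CONVEX `S ⊆ V`, ANY `K ⊆ S`, a minimiser `A*` of
`A ↦ ‖d A‖²` over `S` that lies in `K`, and a minimiser `Ā` of the same functional over `K`: `d Ā = d A*`.  (Both values equal the minimum `m`; the midpoint lies in `S`,
so `‖d(midpoint)‖² ≥ m`, and the parallelogram law gives `‖d Ā − d A*‖² ≤ 0`.) [folklore] -/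
theorem map_eq_of_isMinOn_subset (d : V →ₗ[ℝ] W) {S K : Set V} (hKS : K ⊆ S) (hS : Convex ℝ S)
    {Astar Abar : V} (hstarK : Astar ∈ K) (hbarK : Abar ∈ K)
    (hstar : IsMinOn (fun A => ‖d A‖ ^ 2) S Astar) (hbar : IsMinOn (fun A => ‖d A‖ ^ 2) K Abar) :
    d Abar = d Astar := by
  -- the two minima coincide
  have h₁ : ‖d Abar‖ ^ 2 ≤ ‖d Astar‖ ^ 2 := hbar hstarK
  have h₂ : ‖d Astar‖ ^ 2 ≤ ‖d Abar‖ ^ 2 := hstar (hKS hbarK)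
  -- the midpoint lies in the convex set `S`
  have hmid : (1 / 2 : ℝ) • Abar + (1 / 2 : ℝ) • Astar ∈ S :=
    hS (hKS hbarK) (hKS hstarK) (by norm_num) (by norm_num) (by norm_num)
  have h₃ : ‖d Astar‖ ^ 2 ≤ ‖d ((1 / 2 : ℝ) • Abar + (1 / 2 : ℝ) • Astar)‖ ^ 2 := hstar hmid
  -- parallelogram law
  have hpar := parallelogram_law_with_norm ℝ (d Abar) (d Astar)
  have hlin : d ((1 / 2 : ℝ) • Abar + (1 / 2 : ℝ) • Astar) = (1 / 2 : ℝ) • (d Abar + d Astar) := by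
    rw [map_add, map_smul, map_smul, smul_add]
  rw [hlin, norm_smul, Real.norm_of_nonneg (by norm_num : (0 : ℝ) ≤ 1 / 2)] at h₃
  have hsq : ‖d Abar + d Astar‖ ^ 2 + ‖d Abar - d Astar‖ ^ 2 = 2 * (‖d Abar‖ ^ 2 + ‖d Astar‖ ^ 2) := hpar
  have hdiff : ‖d Abar - d Astar‖ ^ 2 ≤ 0 := by nlinarith [h₁, h₂, h₃, hsq, sq_nonneg ‖d Abar + d Astar‖]
  have hzero : ‖d Abar - d Astar‖ = 0 := by nlinarith [norm_nonneg (d Abar - d Astar), hdiff, sq_nonneg ‖d Abar - d Astar‖]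
  exact sub_eq_zero.mp (norm_eq_zero.mp hzero)

/-- **CAPS READ THROUGH `d` TAKE THE SAME VALUES AT EVERY CAPPED MINIMISER AS AT THE FREE ONE**: for any predicate `P` on `W` (a family of curvature caps, strict or not),
`P (d Ā) ↔ P (d A*)` under the hypotheses of `map_eq_of_isMinOn_subset`. [folklore] -/
theorem cap_iff_of_isMinOn_subset (d : V →ₗ[ℝ] W) {S K : Set V} (hKS : K ⊆ S) (hS : Convex ℝ S)
    {Astar Abar : V} (hstarK : Astar ∈ K) (hbarK : Abar ∈ K)
    (hstar : IsMinOn (fun A => ‖d A‖ ^ 2) S Astar) (hbar : IsMinOn (fun A => ‖d A‖ ^ 2) K Abar) (P : W → Prop) :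
    P (d Abar) ↔ P (d Astar) := by
  rw [map_eq_of_isMinOn_subset d hKS hS hstarK hbarK hstar hbar]

/-- ★ **INTERIORITY IN THE CONVEX MODEL**: if the capped set is `K = S ∩ {A | ∀ i, c i (d A) ≤ ρ i}` (caps through `d`, e.g. the plaquette caps `A_p ≤ ½R²L^{−4k}`) and the
free minimiser `A*` over the convex fibre `S` satisfies every cap STRICTLY, then every minimiser `Ā` over `K` satisfies every cap STRICTLY — no cap is active at a capped
minimiser («no plastic zone for small load»). [folklore] -/
theorem strictCap_of_isMinOn_subset {ι : Type*} (d : V →ₗ[ℝ] W) {S : Set V} (hS : Convex ℝ S) (c : ι → W → ℝ) (ρ : ι → ℝ)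
    {Astar Abar : V} (hstarS : Astar ∈ S) (hstrict : ∀ i, c i (d Astar) < ρ i)
    (hstar : IsMinOn (fun A => ‖d A‖ ^ 2) S Astar)
    (hbarK : Abar ∈ S ∩ {A | ∀ i, c i (d A) ≤ ρ i})
    (hbar : IsMinOn (fun A => ‖d A‖ ^ 2) (S ∩ {A | ∀ i, c i (d A) ≤ ρ i}) Abar) :
    ∀ i, c i (d Abar) < ρ i := by
  have hstarK : Astar ∈ S ∩ {A | ∀ i, c i (d A) ≤ ρ i} := ⟨hstarS, fun i => (hstrict i).le⟩
  rw [map_eq_of_isMinOn_subset d inter_subset_left hS hstarK hbarK hstar hbar]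
  exact hstrict

/-- **THE FLAT STEP IN THE MODEL**: as soon as the free minimiser over `S` lies in the capped set `K ⊆ S`, the capped minimum IS the free minimum — every minimiser over
`K` minimises over `S` (★19200-w4's `Prop7ClosedFibreHalving` §3 read in the convex model: interiority at one radius makes the closed minimiser a minimiser of the open
problem). [folklore] -/
theorem isMinOn_of_isMinOn_subset_of_mem {X : Type*} {E : X → ℝ} {S K : Set X}
    {Astar Abar : X} (hstarK : Astar ∈ K) (hstar : IsMinOn E S Astar) (hbar : IsMinOn E K Abar) :
    IsMinOn E S Abar := by
  intro A hA
  have h₁ : E Abar ≤ E Astar := hbar hstarK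
  have h₂ : E Astar ≤ E A := hstar hA
  exact h₁.trans h₂

/-- **AND NOTHING WEAKER HOLDS**: conversely, if SOME cap is active at SOME capped minimiser `Ā` (`c i (d Ā) = ρ i`), then the free minimiser over `S` violates a cap or sits
on one (`∃ i, ρ i ≤ c i (d A*)`) — in the convex model interiority of capped minimisers is EQUIVALENT to the strict cap at the free minimiser, so no proof of the former can
avoid an L^∞ statement about the latter. [folklore] -/
theorem exists_cap_le_of_active (d : V →ₗ[ℝ] W) {ι : Type*} {S : Set V} (hS : Convex ℝ S) (c : ι → W → ℝ) (ρ : ι → ℝ)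
    {Astar Abar : V} (hstarS : Astar ∈ S) (hstar : IsMinOn (fun A => ‖d A‖ ^ 2) S Astar)
    (hbarK : Abar ∈ S ∩ {A | ∀ i, c i (d A) ≤ ρ i})
    (hbar : IsMinOn (fun A => ‖d A‖ ^ 2) (S ∩ {A | ∀ i, c i (d A) ≤ ρ i}) Abar)
    {i : ι} (hactive : c i (d Abar) = ρ i) :
    ∃ j, ρ j ≤ c j (d Astar) := by
  by_contra hcon
  push Not at hcon
  have hlt := strictCap_of_isMinOn_subset d hS c ρ hstarS hcon hstar hbarK hbar i
  exact absurd hactive hlt.ne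

end Summit.QuantumFields.YangMills.Theorems.Prop7ClosedFibrePlaqInteriorModel
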